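import Summits.BirchSwinnertonDyer.BirchSwinnertonDyer.Theorems.AdditiveBranchIMCGordTwoRankOneHeegnerKolyvaginUnitDoors
import Summits.BirchSwinnertonDyer.Rank1Residual.O5.GssTwistDictionary
import Summits.BirchSwinnertonDyer.Rank1Residual.O5.HeegnerTwistTamagawaThree
import Summits.BirchSwinnertonDyer.Rank1Residual.Supersingular.DescentLowerBoundRankOne
import Literature.NumberTheory.EllipticCurves.HeegnerPointReflectionProofs
import HarnessLib

/-!
# Route `AdditiveBranchIMC` (rung K1), crux `GordTwoRankOne` (item 19358): the Heegner–Kolyvagin road,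
# Part 23b — the UPPER half and `BSD(E,p)` of JSW shape at an additive prime of Kodaira type `Iₙ*`,
# EVERY ODD `p` (`p = 3` included), image onto, from PUBLISHED facts + ONE unit Heegner twist;
# corollaries on cell (G-ord, `e = 2`) and on cell (G) ∧ ss (`e = 2`, potentially SUPERSINGULAR)
# (cell `bsd-addord`, second prover lane `bsd-addord-k1-c3x`, gen 6; `--supports` only)

HONEST FRAMING. THEOREMS ONLY: no definition, no new named fact, no `sorry`; nothing is booked here; crux
19358 stays OPEN at class level; BSD is not proved by any of this. Per-pair data (`hq hv`, `hqd hvd`,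
`hcard`) are the admitted table / certificate currencies of the books, discharged per pair, never asserted.

WHY. Gen 4's Part 19 §34 (`…UnitDoors`) gave the ENGINE-FREE per-pair doors of JSW shape on cell (G-ord,
`e = 2`) at `p ≥ 5`: UPPER(E,p) ⟸ Kolyvagin 1990 Thm. A at a Manin-good frame + Gross–Zagier + ONE Heegner
twist `E^{d_K}` with `L(E^{d_K},1) ≠ 0` and `p ∤ #Ш(E^{d_K})_an`. Two inputs there were cell-specific and
one was `p ≥ 5`: (a) the Manin-good datum came from the cell's Kodaira type `I₀*` (Part 18a: Mazur–Stevens on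
`Iₙ*`), (b) the Tamagawa transport `ord_p ∏c(E^{d_K}) = ord_p ∏c(E)` was x11b's (`p ≥ 5`). THIS FILE removes
both restrictions: the door is stated for ANY additive prime of Kodaira type `Iₙ*` (`hI`, the one-member
form of the sibling's class hypothesis `ManinFrameIstarClass`, isogeny-invariant by
`IstarIsogenyInvariance.istarClass_of_kodairaSymbolAt_eq_Istar`) at EVERY odd `p` — at `p = 3` the Tamagawa
transport is o5-r2's `padicValNat_tamagawaProduct_twist_of_heegner_three` (`3 ∤ d_K`, automatic: `3 ∣ N`
splits in a Heegner field, `not_dvd_discr_of_satisfiesHeegnerHypothesis`). Kolyvagin's bound (tree fact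
`Kolyvagin1990_padicValNat_card_sha_le`, McCallum 1991 §1 as printed: `p` odd, `ρ̄_{E,p}` onto) is blind to
the reduction type at `p`. COROLLARIES (Part 23c, `…IstarDoorsCells`): (i) cell (G-ord, `e = 2`) at every odd `p` (type `Iₙ*` by Part 18a
§29); (ii) cell **(G) ∧ ss, `e = 2`** (`Additive.SubGss`: odd additive `p`, the `p*`-twist GOOD SUPERSINGULAR —
row B4 'Gss2' of the programme, cell `bsd-potss`): type `Iₙ*` by Tate's algorithm Steps 6–7 on the good
supersingular twist (`O5.exists_goodSS_twist_pStar_of_subGss`, NEW §13) — so the JSW-shape UPPER door needs NO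
ordinarity: on the (G) ∧ ss rank-one rows `BSD(E,p)` ⟸ PUB + LOWER(E,p) + one unit Heegner twist, and
LOWER(E,p) is either free (`p ∤ #Ш(E)_an`) or ONE exact `p`-descent certificate `p^{r_an+1} ∣ #Sel^(p)(E/ℚ)`
when `ord_p #Ш(E)_an ≤ 2` (b2b's Cassels–Tate door
`Supersingular.missingLowerBoundAt_of_casselsTate_of_pow_succ_dvd_card_selmerGroup`). No `p`-adic
`L`-function, no `p`-adic height, no Schneider, no `A′`, no signed/±-theory at the additive prime.

CENSUS USE (lane-B instrument `k1-c3x-inst1`, kit j292847, evidence on item 19358; ledger of record A2 R977):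
the live rank-one residue of the `e = 2` additive rows is — (G-ord): 13 cells at `p ∈ {5,7}`, ALL with
`#Ш_an = 1` and non-surjective `ρ̄` (9 × 5S4, 3 × 5Ns, 1 × 7Ns; out of reach of `hsurj`); (G) ∧ ss: 24 cells at
`p ≥ 5` (all `p ∣ ∏c(E)`, out of reach of `htam`) and 8 at `p = 3` with `#Ш(E)_an = 9`, `ρ̄_{E,3}` onto, of which
six — 182853c1, 228897c1, 250065g1, 355338h1, 409248cy1, 439794p1 — have `3 ∤ ∏c(E)` and a unit Heegner
twist in `|d_K| ≤ 400` (j292847): THERE `bsdp_rankOne_subGss_of_cardSelmer_of_twistShaAnUnit` is a per-pair road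
(one 3-descent certificate `9 ∣ #Sel^(3)(E/ℚ)` + the twist's `L`-value datum). Nothing is booked by this file.

References: [JetchevSkinnerWan2017] §7.4.1–7.4.3; [KolyvaginEulerSystems1990] Thm. A; [McCallumLMS1991] §1;
[GrossZagier1986] V.§2; [SilvermanATAEC1994] IV.9.4 Steps 6–7, Cor. IV.9.2(d); [Mazur1978] Cor. 4.1;
[AbbesUllmo1996] Thm. A; [Cesnavicius2018] Thm. 1.2; [Darmon2004] Thm. 3.6; [SilvermanAEC2009] X.4.14;
[Miller2011LMS] Def. 1.1; [Delbourgo1998] §1.5 (G).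
-/

set_option autoImplicit false
set_option linter.dupNamespace false
noncomputable section
open scoped Classical NumberField
open WeierstrassCurve NumberField IsDedekindDomain IsDedekindDomain.HeightOneSpectrum Rat.HeightOneSpectrum
  Literature.NumberTheory.DiophantineGeometry Literature.NumberTheory.EllipticCurves
  Literature.NumberTheory.EllipticCurves.ModularForms Literature.NumberTheory.EllipticCurves.Rank1Residual
  Literature.NumberTheory.EllipticCurves.Rank1Residual.Typed Literature.NumberTheory.Automorphic
  Summit.BirchSwinnertonDyer.Rank1Residual Summit.BirchSwinnertonDyer.Rank1Residual.Additive
  Summit.BirchSwinnertonDyer.Rank1Residual.X11b Summit.BirchSwinnertonDyer.Rank1Residual.GaloisImage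
  Summit.BirchSwinnertonDyer.BirchSwinnertonDyer.Theses.AdditiveKolyvaginRoad
  Summit.BirchSwinnertonDyer.BirchSwinnertonDyer.Theorems.AdditiveKolyvaginKernel
  Summit.BirchSwinnertonDyer.BirchSwinnertonDyer.Theorems

namespace Summit.BirchSwinnertonDyer.BirchSwinnertonDyer.Theorems.AdditiveBranchIMCGordTwoRankOne.HeegnerKolyvagin

/-! ### §13 Cell (G) ∧ ss, `e = 2`, is of Kodaira type `Iₙ*` at `p` — every odd `p` -/

/-- **Cell (G) ∧ ss is of Kodaira type `Iₙ*` at the place of `ℤ` under `p`, at EVERY odd `p`.** For `W/ℚ`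
globally minimal, `p` odd, `E` additive at `p` with `Additive.SubGss W p` ((G) and the `p*`-twist good
SUPERSINGULAR): o5's supply theorem `O5.exists_goodSS_twist_pStar_of_subGss` gives a globally minimal model `V`
of `E^{(p*)}` GOOD at `p`; `W ≅ C • V^{(p*)}` with `p ∥ p*`, so Tate's algorithm Steps 6–7
(`Additive.kodairaSymbolAt_twist_of_semistable`) return `Iₙ*` at the place over `p`. Part 18a §29's proof with the
ordinary twist replaced by the supersingular one. [cite: SilvermanATAEC1994, IV.9.4 Steps 6–7 (PDF pp. 345–346) and Table 4.1]
[cite: Delbourgo1998, §1.5 (G)] -/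
theorem exists_kodairaSymbolAt_eq_Istar_of_subGss
    (W : WeierstrassCurve ℚ) [W.IsElliptic] [W.IsGloballyMinimal] (p : ℕ) [Fact p.Prime]
    (hp2 : p ≠ 2) (hadd : Addv W p) (hss : SubGss W p) :
    ∃ (v : HeightOneSpectrum ℤ) (n : ℕ), natGenerator v = p ∧ W.kodairaSymbolAt v = .Istar n := by
  have hp : p.Prime := Fact.out
  -- the `p*`-twist `V` of `W`, globally minimal, GOOD (supersingular) at `p`
  obtain ⟨V, _, _, C, hC, hgood⟩ := O5.exists_goodSS_twist_pStar_of_subGss W p hp2 hadd hss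
  have hVgood : V.HasGoodReductionAtPrime p := hgood.1
  set d : ℤ := (-1 : ℤ) ^ (p / 2) * p with hd
  obtain ⟨hd0, h1, h2⟩ := IstarIsogenyInvariance.pStar_dvd_facts hp
  have hdQ : ((d : ℤ) : ℚ) = (-1 : ℚ) ^ (p / 2) * p := by push_cast [hd]; ring
  have hd0Q : (d : ℚ) ≠ 0 := by exact_mod_cast hd0
  have hC' : C • W.quadraticTwist (d : ℚ) = V := by rw [hdQ]; exact hC
  obtain ⟨C', hC'W⟩ := exists_variableChange_quadraticTwist_symm V W hd0Q ⟨C, hC'⟩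
  set v' : HeightOneSpectrum (𝓞 ℚ) := (primesEquiv (R := 𝓞 ℚ)).symm ⟨p, hp⟩ with hv'
  have hkey : primesEquiv v' = ⟨p, hp⟩ := (primesEquiv (R := 𝓞 ℚ)).apply_symm_apply _
  have hvnat : ((primesEquiv v' : Nat.Primes) : ℕ) = p := congrArg Subtype.val hkey
  have hv2 : ((primesEquiv v' : Nat.Primes) : ℕ) ≠ 2 := by rw [hvnat]; exact hp2
  have hVv : V.HasGoodReductionAt v' := by
    have hiff := hasGoodReductionAtPrime_iff_hasGoodReductionAt_ringOfIntegers v' V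
    simp only [hkey] at hiff
    exact hiff.mp hVgood
  obtain ⟨n, hn⟩ := Additive.kodairaSymbolAt_twist_of_semistable v' V hv2 hd0
    (by rw [hvnat]; exact h1) (by rw [hvnat]; exact h2) (Or.inl hVv) C' hC'W
  set v : HeightOneSpectrum ℤ := (primesEquiv (R := ℤ)).symm ⟨p, hp⟩ with hv
  have hkeyZ : primesEquiv v = ⟨p, hp⟩ := (primesEquiv (R := ℤ)).apply_symm_apply _
  have hvv' : primesEquiv v = primesEquiv v' := by rw [hkeyZ, hkey]
  refine ⟨v, n, congrArg Subtype.val hkeyZ, ?_⟩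
  rw [O5.FlexNormalForm.kodairaSymbolAt_eq_of_primesEquiv_eq' W v v' hvv']
  exact hn

/-! ### §14 The Manin-unit Heegner datum at an additive prime of type `Iₙ*`, every odd `p` -/

/-- **The Manin-unit Heegner datum at a GIVEN Heegner field, from Kodaira type `Iₙ*` at `p`** (the one-member
form): `W` globally minimal with `W.kodairaSymbolAt v = Iₙ*` at the place of generator the odd prime `p`,
`E[p]` irreducible, `K` imaginary quadratic Heegner for `N(W)` ⟹ a parametrisation datum `Dt` with
`p ∤ c(Dt)`, a Heegner datum `H` of discriminant `d_K`, `ι : K → ℂ` and `P ∈ E(K)` over the complex Heegner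
point. Chain: `Iₙ*` is an isogeny-class property (`IstarIsogenyInvariance.istarClass_of_kodairaSymbolAt_eq_Istar`),
Mazur–Stevens / Edixhoven on the class (`ManinFrameFromDatum.exists_modularParametrizationData_not_dvd_of_istarClass`,
cite-only `hMz hAU hC2`), Darmon 2004 Thm. 3.6 (`ManinFrameFromDatum.exists_maninDatum_of_exists_not_dvd`).
[cite: Darmon2004, Thm. 3.6–3.7 (PDF pp. 43–44)] [cite: EdixhovenManin1991, §1] [cite: Mazur1978, Cor. 4.1]
[cite: AbbesUllmo1996, Thm. A] [cite: Cesnavicius2018, Thm. 1.2] -/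
theorem exists_maninDatum_of_istar_of_irr (hnf : exists_isNewformOf)
    (hMz : mazur_not_dvd_maninConstant_of_odd)
    (hAU : abbesUllmo_not_dvd_maninConstant_of_not_dvd_level)
    (hC2 : cesnavicius_not_two_dvd_maninConstant_of_two_dvd_level)
    (W : WeierstrassCurve ℚ) [W.IsElliptic] [W.IsGloballyMinimal] [NeZero (W.conductorNorm ℤ)]
    (p : ℕ) [Fact p.Prime] (K : Type) [Field K] [NumberField K] (hp2 : p ≠ 2)
    (hI : ∃ (v : HeightOneSpectrum ℤ) (n : ℕ), natGenerator v = p ∧ W.kodairaSymbolAt v = .Istar n)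
    (hirr : Irr W p) (hK : IsImaginaryQuadratic K) (hH : SatisfiesHeegnerHypothesis (W.conductorNorm ℤ) K) :
    ∃ (Dt : ModularParametrizationData W (W.conductorNorm ℤ))
      (H : HeegnerDatum (W.conductorNorm ℤ) (NumberField.discr K))
      (ι : K →+* ℂ) (P : (W.baseChange K).toAffine.Point),
      WeierstrassCurve.Affine.Point.map ι.toRatAlgHom P = heegnerPointComplex Dt H ∧
        ¬ (p : ℤ) ∣ Dt.c := by
  obtain ⟨v, n, hv, hKod⟩ := hI
  exact ManinFrameFromDatum.exists_maninDatum_of_exists_not_dvd W p (W.conductorNorm ℤ) K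
    (ManinFrameFromDatum.exists_modularParametrizationData_not_dvd_of_istarClass hnf hMz hAU hC2 W rfl p hp2 hirr
      (IstarIsogenyInvariance.istarClass_of_kodairaSymbolAt_eq_Istar hp2 v hv hKod)) hK hH

/-! ### §15 UPPER(E,p) at an additive `Iₙ*` prime from PUB + ONE unit Heegner twist — every odd `p` -/

/-- **The Heegner-twist Tamagawa transport at every odd `p ∣ N`**: `ord_p ∏c(E^{d_K}) = ord_p ∏c(E)` for `K`
Heegner for `N(W)` and `p ∣ N(W)` (so `p` splits in `K` and `p ∤ d_K`,
`not_dvd_discr_of_satisfiesHeegnerHypothesis`): at `p ≥ 5` x11b's `padicValNat_tamagawaProduct_twist_of_heegner`,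
at `p = 3` o5's `padicValNat_tamagawaProduct_twist_of_heegner_three`.
[cite: JetchevSkinnerWan2017, §7.4.1 (eq:tamK) (pp. 29–31)] [cite: SilvermanATAEC1994, Cor. IV.9.2(d) and Table 4.1] -/
theorem padicValNat_tamagawaProduct_twist_of_heegner_odd
    (W : WeierstrassCurve ℚ) [W.IsElliptic] [W.IsGloballyMinimal] (p : ℕ) [Fact p.Prime] (hp2 : p ≠ 2)
    (hpN : p ∣ W.conductorNorm ℤ) (K : Type) [Field K] [NumberField K]
    (hK : IsImaginaryQuadratic K) (hH : SatisfiesHeegnerHypothesis (W.conductorNorm ℤ) K)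
    (Wd : WeierstrassCurve ℚ) [Wd.IsElliptic] (Cd : VariableChange ℚ)
    (hWd : Cd • W.quadraticTwist (NumberField.discr K : ℚ) = Wd) :
    padicValNat p Wd.tamagawaProduct = padicValNat p W.tamagawaProduct := by
  have hp : p.Prime := Fact.out
  have hpd : ¬ (p : ℤ) ∣ NumberField.discr K := not_dvd_discr_of_satisfiesHeegnerHypothesis hK hH hp hpN
  rcases eq_three_or_five_le_of_prime_ne_two p hp hp2 with rfl | hp5
  · exact O5.TwistTamagawa.padicValNat_tamagawaProduct_twist_of_heegner_three W Wd K hK hH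
      (by exact_mod_cast hpd) Cd hWd
  · exact padicValNat_tamagawaProduct_twist_of_heegner W p hp5 K hK hH Cd hWd

/-- **UPPER(E,p) per pair at an ADDITIVE prime of Kodaira type `Iₙ*`, EVERY ODD `p`, from PUBLISHED facts + the
unit value datum of ONE Heegner twist.** Row: `W/ℚ` globally minimal, `r_an = 1`, `p` odd, `E` additive at `p` of
Kodaira type `Iₙ*` (`hI`; holds on cells (G-ord, `e = 2`), (G) ∧ ss `e = 2`, and (M)), `ρ̄_{E,p}` onto,
`p ∤ ∏c_ℓ(E)`. Datum: an imaginary quadratic `K`, Heegner for `N(W)`, with `L(E^{d_K},1) ≠ 0`, a globally minimal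
model `Wd = Cd • E^{d_K}`, and `#Ш(Wd)_an = qd` with `ord_p qd ≤ 0`. PUB: `hGZ hKo hB hGZK hmod hnf` + cite-only
`hMz hAU hC2`. Conclusion: `Typed.MissingUpperBoundAt W p` (`ord_p #Ш(E) ≤ ord_p #Ш(E)_an`). Arithmetic (JSW
§7.4.2 at `p² ∣ N`): `v(Ш_E) + v(Ш_d) = v(Ш_K) ≤ 2v[E(K):ℤP] = v(Ш_E,an) + v(Ш_d,an) + 2v(∏c(E)) − 2v(t_d)` and the
twist's LOWER half is free on its unit window; `ord_p u(Cd) = 0` (Part 1), `p ∤ #𝓞_K^×` (Part 12) and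
`ord_p ∏c(Wd) = ord_p ∏c(W)` (`padicValNat_tamagawaProduct_twist_of_heegner_odd`) are automatic. No engine, no
`p`-adic object, no ordinarity. [cite: JetchevSkinnerWan2017, §7.4.2 (eq:shaupper), p. 31]
[cite: McCallumLMS1991, §1 Theorem (Kolyvagin), p. 296] [cite: EdixhovenManin1991, §1] [cite: Mazur1978, Cor. 4.1]
[cite: AbbesUllmo1996, Thm. A] [cite: Darmon2004, Thm. 3.6] [cite: Miller2011LMS, Def. 1.1] -/
theorem missingUpperBoundAt_rankOne_istar_of_twistShaAnUnit
    (hGZ : ∀ (N : ℕ) [NeZero N] (W : WeierstrassCurve ℚ) (K : Type) [Field K] [NumberField K],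
      gross_zagier N W K)
    (hKo : ∀ (N : ℕ) [NeZero N] (W : WeierstrassCurve ℚ) (K : Type) [Field K] [NumberField K],
      kolyvagin N W K)
    (hB : ∀ (N : ℕ) [NeZero N] (W : WeierstrassCurve ℚ) (K : Type) [Field K] [NumberField K],
      Kolyvagin1990_padicValNat_card_sha_le N W K)
    (hGZK : rank_eq_analyticRank_of_analyticRank_le_one) (hmod : hasEntireLFunction_rat)
    (hnf : exists_isNewformOf)
    (hMz : mazur_not_dvd_maninConstant_of_odd)
    (hAU : abbesUllmo_not_dvd_maninConstant_of_not_dvd_level)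
    (hC2 : cesnavicius_not_two_dvd_maninConstant_of_two_dvd_level)
    (W : WeierstrassCurve ℚ) [W.IsElliptic] [W.IsGloballyMinimal] (p : ℕ) [Fact p.Prime]
    (K : Type) [Field K] [NumberField K]
    (Wd : WeierstrassCurve ℚ) [Wd.IsElliptic] [Wd.IsGloballyMinimal] (Cd : VariableChange ℚ)
    (hr : W.analyticRank = 1) (hp2 : p ≠ 2) (hadd : Addv W p)
    (hI : ∃ (v : HeightOneSpectrum ℤ) (n : ℕ), natGenerator v = p ∧ W.kodairaSymbolAt v = .Istar n)
    (hsurj : W.HasSurjectiveModNGaloisRep p) (htam : ¬ p ∣ W.tamagawaProduct)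
    (hK : IsImaginaryQuadratic K) (hHN : SatisfiesHeegnerHypothesis (W.conductorNorm ℤ) K)
    (hLt : (W.quadraticTwist (NumberField.discr K : ℚ)).entireLFunction 1 ≠ 0)
    (hWd : Cd • W.quadraticTwist (NumberField.discr K : ℚ) = Wd)
    {qd : ℚ} (hqd : shaAn Wd = (qd : ℂ)) (hvd : padicValRat p qd ≤ 0) :
    Typed.MissingUpperBoundAt W p := by
  have hp : p.Prime := Fact.out
  haveI : NeZero (W.conductorNorm ℤ) := ⟨(W.conductorNorm_pos_holds).ne'⟩
  have hirr : Irr W p := hasIrreducibleModPGaloisRep_of_hasSurjectiveModNGaloisRep W p hsurj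
  have hpN : p ∣ W.conductorNorm ℤ := (W.dvd_conductorNorm_iff_not_hasGoodReductionAtPrime p).mpr hadd.1
  have hμ : ¬ p ∣ Units.torsionOrder K := not_dvd_unitsTorsionOrder_of_heegner hK hHN hp hp2 hpN
  -- the Manin-good Heegner datum at `K` (Mazur–Stevens on `Iₙ*`)
  obtain ⟨Dt, H, ι, P, hP, hc⟩ := exists_maninDatum_of_istar_of_irr hnf hMz hAU hC2 W p K hp2 hI hirr hK hHN
  -- the twist's LOWER half is free on its unit window
  have htwL : Typed.MissingLowerBoundAt Wd p := N10.missingLowerBoundAt_of_padicValRat_le_zero Wd p hqd hvd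
  -- Part 6's argument at every odd `p`
  have hD0 : (NumberField.discr K : ℚ) ≠ 0 := by exact_mod_cast NumberField.discr_ne_zero K
  haveI hEt : (W.quadraticTwist (NumberField.discr K : ℚ)).IsElliptic := W.isElliptic_quadraticTwist hD0
  have htamEq : padicValNat p Wd.tamagawaProduct = padicValNat p W.tamagawaProduct :=
    padicValNat_tamagawaProduct_twist_of_heegner_odd W p hp2 hpN K hK hHN Wd Cd hWd
  have hu : padicValRat p (Cd.u : ℚ) = 0 :=
    padicValRat_u_eq_zero_of_twist_minimal' W p K hK hHN hadd.1 Cd hWd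
  have hLt' : (W.quadraticTwist (NumberField.discr K : ℚ)).entireLFunction = Wd.entireLFunction := by
    rw [← hWd, entireLFunction_smul]
  have hLd1 : Wd.entireLFunction 1 ≠ 0 := by rw [← hLt']; exact hLt
  have htw := twist_ge_half_of_missingLowerBoundAt hGZK hmod Wd p hLd1 htwL
  have hU : Finite (W.baseChange K).sha → ¬ IsOfFinAddOrder P →
      padicValNat p (Nat.card (W.baseChange K).sha) ≤
        2 * padicValNat p (AddSubgroup.zmultiples P).index :=
    fun _ hnt ↦ hB _ W K hK hHN ⟨Dt, H, ι, hP⟩ hnt hp hp2 hsurj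
  exact missingUpperBoundAt_of_shaIndexBound W p (W.conductorNorm ℤ) K Dt H ι P (hGZ _ W K) (hKo _ W K) hGZK
    hmod hK hHN hP hp2 hc hμ hr hLt Wd Cd hWd hu htamEq htam htw hU

/-! ### §16 `BSD(E,p)` at an additive `Iₙ*` prime: UPPER from §15, LOWER displayed / free / by descent -/

/-- **`BSD(E,p)` per pair at an additive `Iₙ*` prime, every odd `p`: §15's UPPER half + the LOWER half DISPLAYED**
(`hlow : Typed.MissingLowerBoundAt W p` — crux 19358's conclusion at the pair on cell (G-ord, `e = 2`); the
sibling cells' lower halves likewise), glued by x11b's `bsdp_of_halves`.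
[cite: JetchevSkinnerWan2017, §7.4.1–7.4.3 (pp. 29–31)] [cite: McCallumLMS1991, §1 Theorem (Kolyvagin), p. 296]
[cite: Miller2011LMS, §1 and Def. 1.1] -/
theorem bsdp_rankOne_istar_of_lower_of_twistShaAnUnit
    (hGZ : ∀ (N : ℕ) [NeZero N] (W : WeierstrassCurve ℚ) (K : Type) [Field K] [NumberField K],
      gross_zagier N W K)
    (hKo : ∀ (N : ℕ) [NeZero N] (W : WeierstrassCurve ℚ) (K : Type) [Field K] [NumberField K],
      kolyvagin N W K)
    (hB : ∀ (N : ℕ) [NeZero N] (W : WeierstrassCurve ℚ) (K : Type) [Field K] [NumberField K],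
      Kolyvagin1990_padicValNat_card_sha_le N W K)
    (hGZK : rank_eq_analyticRank_of_analyticRank_le_one) (hmod : hasEntireLFunction_rat)
    (hnf : exists_isNewformOf)
    (hMz : mazur_not_dvd_maninConstant_of_odd)
    (hAU : abbesUllmo_not_dvd_maninConstant_of_not_dvd_level)
    (hC2 : cesnavicius_not_two_dvd_maninConstant_of_two_dvd_level)
    (W : WeierstrassCurve ℚ) [W.IsElliptic] [W.IsGloballyMinimal] (p : ℕ) [Fact p.Prime]
    (K : Type) [Field K] [NumberField K]
    (Wd : WeierstrassCurve ℚ) [Wd.IsElliptic] [Wd.IsGloballyMinimal] (Cd : VariableChange ℚ)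
    (hr : W.analyticRank = 1) (hp2 : p ≠ 2) (hadd : Addv W p)
    (hI : ∃ (v : HeightOneSpectrum ℤ) (n : ℕ), natGenerator v = p ∧ W.kodairaSymbolAt v = .Istar n)
    (hsurj : W.HasSurjectiveModNGaloisRep p) (htam : ¬ p ∣ W.tamagawaProduct)
    (hK : IsImaginaryQuadratic K) (hHN : SatisfiesHeegnerHypothesis (W.conductorNorm ℤ) K)
    (hLt : (W.quadraticTwist (NumberField.discr K : ℚ)).entireLFunction 1 ≠ 0)
    (hWd : Cd • W.quadraticTwist (NumberField.discr K : ℚ) = Wd)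
    {qd : ℚ} (hqd : shaAn Wd = (qd : ℂ)) (hvd : padicValRat p qd ≤ 0)
    (hlow : Typed.MissingLowerBoundAt W p) : BSDp W p :=
  bsdp_of_halves hGZK W p (le_of_eq hr) hlow
    (missingUpperBoundAt_rankOne_istar_of_twistShaAnUnit hGZ hKo hB hGZK hmod hnf hMz hAU hC2 W p K Wd Cd hr hp2
      hadd hI hsurj htam hK hHN hLt hWd hqd hvd)

/-- **`BSD(E,p)` per pair at an additive `Iₙ*` prime, every odd `p`, TWO unit data** (`#Ш(E)_an = q` with
`ord_p q ≤ 0`: LOWER(E) free, `N10.missingLowerBoundAt_of_padicValRat_le_zero`; + §15's twist datum).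
[cite: JetchevSkinnerWan2017, §7.4.1–7.4.3 (pp. 29–31)] [cite: McCallumLMS1991, §1 Theorem (Kolyvagin), p. 296]
[cite: Miller2011LMS, §1 and Def. 1.1] -/
theorem bsdp_rankOne_istar_of_shaAnUnit_of_twistShaAnUnit
    (hGZ : ∀ (N : ℕ) [NeZero N] (W : WeierstrassCurve ℚ) (K : Type) [Field K] [NumberField K],
      gross_zagier N W K)
    (hKo : ∀ (N : ℕ) [NeZero N] (W : WeierstrassCurve ℚ) (K : Type) [Field K] [NumberField K],
      kolyvagin N W K)
    (hB : ∀ (N : ℕ) [NeZero N] (W : WeierstrassCurve ℚ) (K : Type) [Field K] [NumberField K],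
      Kolyvagin1990_padicValNat_card_sha_le N W K)
    (hGZK : rank_eq_analyticRank_of_analyticRank_le_one) (hmod : hasEntireLFunction_rat)
    (hnf : exists_isNewformOf)
    (hMz : mazur_not_dvd_maninConstant_of_odd)
    (hAU : abbesUllmo_not_dvd_maninConstant_of_not_dvd_level)
    (hC2 : cesnavicius_not_two_dvd_maninConstant_of_two_dvd_level)
    (W : WeierstrassCurve ℚ) [W.IsElliptic] [W.IsGloballyMinimal] (p : ℕ) [Fact p.Prime]
    (K : Type) [Field K] [NumberField K]
    (Wd : WeierstrassCurve ℚ) [Wd.IsElliptic] [Wd.IsGloballyMinimal] (Cd : VariableChange ℚ)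
    (hr : W.analyticRank = 1) (hp2 : p ≠ 2) (hadd : Addv W p)
    (hI : ∃ (v : HeightOneSpectrum ℤ) (n : ℕ), natGenerator v = p ∧ W.kodairaSymbolAt v = .Istar n)
    (hsurj : W.HasSurjectiveModNGaloisRep p) (htam : ¬ p ∣ W.tamagawaProduct)
    (hK : IsImaginaryQuadratic K) (hHN : SatisfiesHeegnerHypothesis (W.conductorNorm ℤ) K)
    (hLt : (W.quadraticTwist (NumberField.discr K : ℚ)).entireLFunction 1 ≠ 0)
    (hWd : Cd • W.quadraticTwist (NumberField.discr K : ℚ) = Wd)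
    {q : ℚ} (hq : shaAn W = (q : ℂ)) (hv : padicValRat p q ≤ 0)
    {qd : ℚ} (hqd : shaAn Wd = (qd : ℂ)) (hvd : padicValRat p qd ≤ 0) : BSDp W p :=
  bsdp_rankOne_istar_of_lower_of_twistShaAnUnit hGZ hKo hB hGZK hmod hnf hMz hAU hC2 W p K Wd Cd hr hp2 hadd hI
    hsurj htam hK hHN hLt hWd hqd hvd (N10.missingLowerBoundAt_of_padicValRat_le_zero W p hq hv)

/-- **`BSD(E,p)` per pair at an additive `Iₙ*` prime, every odd `p`, the CONTENT rows `p ∣ #Ш(E)_an`,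
`ord_p #Ш(E)_an ≤ 2`: LOWER from ONE exact `p`-descent certificate** `p^{r_an+1} ∣ #Sel^(p)(E/ℚ)` (b2b's
Cassels–Tate door `Supersingular.missingLowerBoundAt_of_casselsTate_of_pow_succ_dvd_card_selmerGroup`, `hCT` =
Cassels–Tate, PUBLISHED; `p ∤ #E(ℚ)_tors` automatic from irreducibility) + §15's UPPER from the unit twist datum.
This is the per-pair road for the rank-one (G) ∧ ss `e = 2` residue at `p = 3` with `#Ш(E)_an = 9` (module
docstring). [cite: SilvermanAEC2009, Thm. X.4.14] [cite: JetchevSkinnerWan2017, §7.4.1–7.4.3 (pp. 29–31)]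
[cite: McCallumLMS1991, §1 Theorem (Kolyvagin), p. 296] [cite: Miller2011LMS, §1 and Def. 1.1] -/
theorem bsdp_rankOne_istar_of_cardSelmer_of_twistShaAnUnit
    (hCT : exists_casselsTate_pairing (K := ℚ))
    (hGZ : ∀ (N : ℕ) [NeZero N] (W : WeierstrassCurve ℚ) (K : Type) [Field K] [NumberField K],
      gross_zagier N W K)
    (hKo : ∀ (N : ℕ) [NeZero N] (W : WeierstrassCurve ℚ) (K : Type) [Field K] [NumberField K],
      kolyvagin N W K)
    (hB : ∀ (N : ℕ) [NeZero N] (W : WeierstrassCurve ℚ) (K : Type) [Field K] [NumberField K],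
      Kolyvagin1990_padicValNat_card_sha_le N W K)
    (hGZK : rank_eq_analyticRank_of_analyticRank_le_one) (hmod : hasEntireLFunction_rat)
    (hnf : exists_isNewformOf)
    (hMz : mazur_not_dvd_maninConstant_of_odd)
    (hAU : abbesUllmo_not_dvd_maninConstant_of_not_dvd_level)
    (hC2 : cesnavicius_not_two_dvd_maninConstant_of_two_dvd_level)
    (W : WeierstrassCurve ℚ) [W.IsElliptic] [W.IsGloballyMinimal] (p : ℕ) [Fact p.Prime]
    (K : Type) [Field K] [NumberField K]
    (Wd : WeierstrassCurve ℚ) [Wd.IsElliptic] [Wd.IsGloballyMinimal] (Cd : VariableChange ℚ)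
    (hr : W.analyticRank = 1) (hp2 : p ≠ 2) (hadd : Addv W p)
    (hI : ∃ (v : HeightOneSpectrum ℤ) (n : ℕ), natGenerator v = p ∧ W.kodairaSymbolAt v = .Istar n)
    (hsurj : W.HasSurjectiveModNGaloisRep p) (htam : ¬ p ∣ W.tamagawaProduct)
    (hK : IsImaginaryQuadratic K) (hHN : SatisfiesHeegnerHypothesis (W.conductorNorm ℤ) K)
    (hLt : (W.quadraticTwist (NumberField.discr K : ℚ)).entireLFunction 1 ≠ 0)
    (hWd : Cd • W.quadraticTwist (NumberField.discr K : ℚ) = Wd)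
    {q : ℚ} (hq : shaAn W = (q : ℂ)) (hv2 : padicValRat p q ≤ 2)
    (hcard : p ^ (W.analyticRank + 1) ∣ Nat.card (W.selmerGroup (p : ℤ)))
    {qd : ℚ} (hqd : shaAn Wd = (qd : ℂ)) (hvd : padicValRat p qd ≤ 0) : BSDp W p :=
  have hirr : Irr W p := hasIrreducibleModPGaloisRep_of_hasSurjectiveModNGaloisRep W p hsurj
  bsdp_rankOne_istar_of_lower_of_twistShaAnUnit hGZ hKo hB hGZK hmod hnf hMz hAU hC2 W p K Wd Cd hr hp2 hadd hI
    hsurj htam hK hHN hLt hWd hqd hvd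
    (Supersingular.missingLowerBoundAt_of_casselsTate_of_pow_succ_dvd_card_selmerGroup W p hCT hGZK (le_of_eq hr)
      (Supersingular.not_dvd_torsionOrder_of_irr W p hirr) hq hv2 hcard)

end Summit.BirchSwinnertonDyer.BirchSwinnertonDyer.Theorems.AdditiveBranchIMCGordTwoRankOne.HeegnerKolyvagin

end
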